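import Summits.QuantumFields.YangMills.Theorems.LuscherReductionTwistedTraceScalingBTRatesBudget
import HarnessLib

/-!
# (C4-CORE rates) SUPER-POLYNOMIAL PIECES ARE `o(λ_bare)`: the `hb_small` clause for rates of the form `e^{K − q·log²β}·β^{m}`
# (lane A of S-BASE, crux `TwistedTraceScaling` stmt-QuantumFields-20203, C4-CORE, the (OD) pen; `pub/ym-fleet/ym-luscher-20007-p1/HANDOFF-g20.md` (γ))

The three absolute defect pieces (FP tail, outer region, dual-BO shell) divided by the currency floor `c_R·β^{-K}·e^{4β|E|}` (`…BOCurrencyFloor.currency_floor`)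
are rates `b_i(β)² ≤ e^{K_c − q·log²β}/(β^{-1})^m`; this file turns any such bound into the record clause `∀ a > 0, ∀ᶠ β, b_i β² ≤ a·bareLambda(L³β)`:
★ `sq_rate_small_of_exp_logsq` (via `…BTRatesBudget.eventually_exp_logsq_le` and `bareLambda(B) ≥ 2/B` for `B ≥ 2`), plus `exp_neg_btLog_sq_le` (`ℓ = btLog β ≥ log β` for `β ≥ 1`).
HONEST FRAMING: bookkeeping for a stub of a child of the CONDITIONAL route R2b1; the hOD assembly, (B-ST), C4-CORE remain OPEN; not a gap, not Clay.
-/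

set_option autoImplicit false

noncomputable section

open Filter Topology Real
open Literature.MathematicalPhysics.QuantumFieldTheory
open Literature.MathematicalPhysics.QuantumLattice

namespace Summit.QuantumFields.YangMills.Theorems.FemtoTransferGap.TwoLattice.ConstTube

open Summit.QuantumFields.YangMills.Theorems.FemtoTransferGap
open Summit.QuantumFields.YangMills.Theorems.FemtoTransferGap.TwoLattice

variable {L : ℕ} [NeZero L]

omit [NeZero L] in
/-- `λ_bare(B) = (2/B)^{1/3} ≥ 2/B` for `B ≥ 2`. [cite: Luscher1983, §1] -/
theorem bareLambda_ge_two_div {B : ℝ} (hB : 2 ≤ B) : 2 / B ≤ bareLambda B := by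
  unfold bareLambda
  have hB0 : 0 < B := by linarith
  have hx0 : 0 < 2 / B := by positivity
  have hx1 : 2 / B ≤ 1 := (div_le_one hB0).mpr hB
  have h := Real.rpow_le_rpow_of_exponent_ge hx0 hx1 (show (1 : ℝ) / 3 ≤ 1 by norm_num)
  rwa [Real.rpow_one] at h

omit [NeZero L] in
/-- `e^{−qℓ²} ≤ e^{−q·log²β}` for `β ≥ 1`, `q ≥ 0` (`ℓ = btLog β = max(log β, 1) ≥ log β ≥ 0`). [folklore] -/
theorem exp_neg_btLog_sq_le {q β : ℝ} (hq : 0 ≤ q) (hβ : 1 ≤ β) : Real.exp (-(q * btLog β ^ 2)) ≤ Real.exp (-(q * Real.log β ^ 2)) := by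
  rw [Real.exp_le_exp, neg_le_neg_iff]
  have h0 : 0 ≤ Real.log β := Real.log_nonneg hβ
  have h1 : Real.log β ≤ btLog β := le_max_left _ _
  exact mul_le_mul_of_nonneg_left (pow_le_pow_left₀ h0 h1 2) hq

omit [NeZero L] in
/-- `e^{−qℓ²} ≤ e^{−q}` (`ℓ ≥ 1`), for `q ≥ 0`. [folklore] -/
theorem exp_neg_btLog_sq_le_exp_neg {q : ℝ} (hq : 0 ≤ q) (β : ℝ) : Real.exp (-(q * btLog β ^ 2)) ≤ Real.exp (-q) := by
  rw [Real.exp_le_exp, neg_le_neg_iff]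
  have h1 : (1 : ℝ) ≤ btLog β ^ 2 := one_le_pow₀ (one_le_btLog β)
  nlinarith

/-- ★ **SUPER-POLYNOMIAL RATES ARE `o(λ_bare(L³β))`**: if eventually `b β² ≤ e^{K_c − q·log²β}/(β^{-1})^m` with `q > 0`, then `∀ a > 0, ∀ᶠ β, b β² ≤ a·bareLambda(L³β)`.
[cite: Luscher1983, §3] -/
theorem sq_rate_small_of_exp_logsq {q Kc : ℝ} (hq : 0 < q) (m : ℕ) {b : ℝ → ℝ}
    (hb : ∀ᶠ β : ℝ in atTop, b β ^ 2 ≤ Real.exp (Kc - q * Real.log β ^ 2) / powScale 1 β ^ m) :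
    ∀ a : ℝ, 0 < a → ∀ᶠ β : ℝ in atTop, b β ^ 2 ≤ a * bareLambda ((L : ℝ) ^ 3 * β) := by
  intro a ha
  have hL1 : (1 : ℝ) ≤ L := by exact_mod_cast NeZero.one_le
  have hL3 : (1 : ℝ) ≤ (L : ℝ) ^ 3 := one_le_pow₀ hL1
  have hC : 0 < a * (2 / (L : ℝ) ^ 3) := by positivity
  filter_upwards [hb, eventually_exp_logsq_le (K := Kc) hq hC (m + 1), eventually_ge_atTop (2 : ℝ)] with β hbβ hexp hβ2
  have hβ1 : 1 ≤ β := by linarith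
  have hps : 0 < powScale 1 β := powScale_pos 1 β
  have hps1 : powScale 1 β = β⁻¹ := by rw [powScale_eq hβ1, Real.rpow_neg_one]
  -- `e^{Kc − q log²β}/ps1^m ≤ a·(2/L³)·ps1 = a·(2/(L³β)) ≤ a·λ_bare(L³β)`
  have h1 : Real.exp (Kc - q * Real.log β ^ 2) / powScale 1 β ^ m ≤ a * (2 / (L : ℝ) ^ 3) * powScale 1 β := by
    rw [div_le_iff₀ (pow_pos hps m)]
    calc Real.exp (Kc - q * Real.log β ^ 2) ≤ a * (2 / (L : ℝ) ^ 3) * powScale 1 β ^ (m + 1) := hexp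
      _ = a * (2 / (L : ℝ) ^ 3) * powScale 1 β * powScale 1 β ^ m := by rw [pow_succ]; ring
  have hB : 2 ≤ (L : ℝ) ^ 3 * β := by nlinarith
  have h2 : a * (2 / (L : ℝ) ^ 3) * powScale 1 β = a * (2 / ((L : ℝ) ^ 3 * β)) := by
    rw [hps1]; field_simp
  have h3 : a * (2 / ((L : ℝ) ^ 3 * β)) ≤ a * bareLambda ((L : ℝ) ^ 3 * β) := mul_le_mul_of_nonneg_left (bareLambda_ge_two_div hB) ha.le
  linarith [hbβ, h1, h2.le, h3]

/-- ★ The same with the budget written in `ℓ = btLog β`: if eventually `b β² ≤ P·e^{−qℓ²}/(β^{-1})^m` with `q > 0`, `P ≥ 0` a constant, then `b² = o(λ_bare(L³β))`.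
[cite: Luscher1983, §3] -/
theorem sq_rate_small_of_exp_btLog_sq {q P : ℝ} (hq : 0 < q) (hP : 0 ≤ P) (m : ℕ) {b : ℝ → ℝ}
    (hb : ∀ᶠ β : ℝ in atTop, b β ^ 2 ≤ P * Real.exp (-(q * btLog β ^ 2)) / powScale 1 β ^ m) :
    ∀ a : ℝ, 0 < a → ∀ᶠ β : ℝ in atTop, b β ^ 2 ≤ a * bareLambda ((L : ℝ) ^ 3 * β) := by
  refine sq_rate_small_of_exp_logsq (L := L) (Kc := Real.log (P + 1)) hq m ?_
  filter_upwards [hb, eventually_ge_atTop (1 : ℝ)] with β hbβ hβ1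
  have hps : 0 < powScale 1 β ^ m := pow_pos (powScale_pos 1 β) m
  refine hbβ.trans (div_le_div_of_nonneg_right ?_ hps.le)
  have h1 := exp_neg_btLog_sq_le hq.le hβ1
  have hP1 : P ≤ Real.exp (Real.log (P + 1)) := by rw [Real.exp_log (by linarith)]; linarith
  calc P * Real.exp (-(q * btLog β ^ 2)) ≤ Real.exp (Real.log (P + 1)) * Real.exp (-(q * Real.log β ^ 2)) :=
        mul_le_mul hP1 h1 (Real.exp_pos _).le (Real.exp_pos _).le
    _ = Real.exp (Real.log (P + 1) - q * Real.log β ^ 2) := by rw [← Real.exp_add]; ring_nf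

end Summit.QuantumFields.YangMills.Theorems.FemtoTransferGap.TwoLattice.ConstTube

end
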